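import Summits.ResolutionOfSingularities.ResolutionOfSingularities.Theorems.WeightedInvariantDescentPerfectToAllOneRootReduceToGeomIntegral
import Literature.AlgebraicGeometry.Resolution.SurfaceResolutionReduction
import Literature.AlgebraicGeometry.Resolution.FiniteBirationalNormal
import Literature.AlgebraicGeometry.Resolution.RegularLocalRingsNormal
import Mathlib.LinearAlgebra.Dual.Lemmas
import Mathlib.Algebra.CharP.Lemmas
import Mathlib.Algebra.CharP.Algebra
import HarnessLib

/-!
# `WeightedInvariant.DescentPerfectToAll`, line `root-of-a-constant`: WLOG `X` normal in the core

Route `ResolutionOfSingularities/WeightedInvariant`, crux `DescentPerfectToAll`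
(stmt-ResolutionOfSingularities-0549), stub `stub_oneRootNormalization` (R3) of the lead's
skeleton, PROVED here (statement verbatim from the ledger registration): for `K = k(α)`,
`α ^ p = a ∈ k ∖ k^p`, the core "`X` integral separated of finite type over `k`,
`X_K = X ×ₖ Spec K` integral with a resolution ⟹ `X` has a resolution" follows from its case
`X` NORMAL.

**Proof.** Let `ν : X^ν → X` be the normalization (finite, E. Noether; birational; `X^ν`
normal). A resolution of `X^ν` gives one of `X` (`Scheme.HasResolution.of_normalization`); the
normal core applies to `X^ν` once (a) `X^ν_K = X^ν ×ₖ Spec K` is integral, (b) it is resolved.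
* (a) `isIntegral_pullback_normalization`: `X^ν_K → X^ν` is a finite radicial surjection, so
  `X^ν_K` is irreducible; it is reduced (`isReduced_pullback_of_forall_pow_ne`, R2) because
  `a ∉ k(X^ν)^p = k(X)^p`: if `a = (b/c)^p` in `k(X) = Frac A`, `U = Spec A ⊆ X` affine, then
  `x = b ⊗ 1 - c ⊗ α ∈ A ⊗ₖ K = Γ(U_K)` has `x ^ p = 0 ≠ x`, but `X_K` is reduced
  (`pow_ne_of_isReduced_tensorProduct`).
* (b) `hasResolution_of_isIntegralHom_of_isBirational`: **resolutions lift along integral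
  birational morphisms `q : M → Z` of integral schemes** — here the base change
  `X^ν_K → X_K` of `ν` (`isBirational_of_isPullback`). If `π : Y → Z` is a resolution, `Y` is
  regular, hence normal (Matsumura 19.4, `isIntegrallyClosed_of_isRegularLocalRing`) and
  integral, and `π` lifts to `s : Y → M` with `s ≫ q = π`
  (`exists_lift_of_isIntegralHom_of_isBirational`: `K(Z) ≅ K(M)` gives `Spec K(Y) → Y ×_Z M`
  over `Y`, and by the universal property of the relative normalization, Mathlib
  `Scheme.Hom.normalizationDesc`, `Y ≅ Y^ν → Y ×_Z M → M` — `Y^ν → Y` being an isomorphism for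
  normal `Y`, Stacks 0AB1); `s` is proper by cancellation and birational
  (`isBirational_of_comp`).

Sources: The Stacks Project, Tags 035I, 0AB1, 01RN [StacksProject]; H. Matsumura,
*Commutative Ring Theory* (1987), Thm. 19.4 [Matsumura1987]; Liu 2002, Cor. 4.1.30 [Liu2002].
-/

set_option linter.dupNamespace false -- mandated namespace of this single-conjunct summit

noncomputable section

open CategoryTheory CategoryTheory.Limits AlgebraicGeometry TopologicalSpace Topology
open Literature.AlgebraicGeometry.Resolution
open scoped TensorProduct

namespace Summit.ResolutionOfSingularities.ResolutionOfSingularities.Theorems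

universe u

/-! ## `a ∉ (Frac A)^p` when `A ⊗ₖ k(a^{1/p})` is reduced -/

section Algebra

variable {k K : Type*} [Field k] [Field K] [Algebra k K] {p : ℕ}

/-- For `α ∈ K` with `α ^ p = a ∉ k ^ p` there is a `k`-linear functional on `K` killing `1` but
not `α` (`α ∉ k · 1`, and `K / k · 1` is a free `k`-module). [folklore] -/
theorem exists_linearMap_map_one_eq_zero (a : k) (α : K) (ha : ∀ b : k, b ^ p ≠ a)
    (hα : α ^ p = algebraMap k K a) : ∃ φ : K →ₗ[k] k, φ 1 = 0 ∧ φ α ≠ 0 := by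
  have hx : α ∉ Submodule.span k {(1 : K)} := by
    rw [Submodule.mem_span_singleton]
    rintro ⟨r, hr⟩
    apply ha r
    apply (algebraMap k K).injective
    rw [map_pow, Algebra.algebraMap_eq_smul_one, hr, hα]
  obtain ⟨φ, hφα, hφ⟩ := Submodule.exists_dual_map_eq_bot_of_notMem hx inferInstance
  refine ⟨φ, (Submodule.mem_bot k).mp ?_, hφα⟩
  exact hφ ▸ Submodule.mem_map_of_mem (Submodule.mem_span_singleton_self _)

/-- **`a ∉ (Frac A)^p` if `A ⊗ₖ k(a^{1/p})` is reduced.** If `γ = b / c ∈ Frac A` satisfies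
`γ ^ p = a`, then `b ^ p = a c ^ p` in `A` and `x = b ⊗ 1 - c ⊗ α ∈ A ⊗ₖ K` satisfies
`x ^ p = b ^ p ⊗ 1 - c ^ p ⊗ a = 0` (characteristic `p`); as `A ⊗ₖ K` is reduced, `x = 0`, and
applying `A ⊗ φ` for a `k`-linear `φ : K → k` with `φ 1 = 0 ≠ φ α` gives `φ(α) c = 0`, i.e.
`c = 0`, a contradiction. [folklore] -/
theorem pow_ne_of_isReduced_tensorProduct [Fact p.Prime] [CharP k p] {A F : Type*} [CommRing A]
    [IsDomain A] [Field F] [Algebra k A] [Algebra k F] [Algebra A F] [IsScalarTower k A F]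
    [IsFractionRing A F] [IsReduced (A ⊗[k] K)] (a : k) (α : K) (ha : ∀ b : k, b ^ p ≠ a)
    (hα : α ^ p = algebraMap k K a) (γ : F) : γ ^ p ≠ algebraMap k F a := by
  intro hγ
  obtain ⟨φ, hφ1, hφα⟩ := exists_linearMap_map_one_eq_zero a α ha hα
  obtain ⟨b, c, hc, rfl⟩ := IsFractionRing.div_surjective (A := A) γ
  have hcF : algebraMap A F c ≠ 0 := IsFractionRing.to_map_ne_zero_of_mem_nonZeroDivisors hc
  have hbc : b ^ p = algebraMap k A a * c ^ p := by
    apply IsFractionRing.injective A F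
    rw [map_mul, map_pow, map_pow, ← IsScalarTower.algebraMap_apply, ← hγ, div_pow,
      div_mul_cancel₀ _ (pow_ne_zero _ hcF)]
  haveI : Nontrivial (A ⊗[k] K) :=
    Algebra.TensorProduct.nontrivial_of_algebraMap_injective_of_isDomain k A K
      (algebraMap k A).injective (algebraMap k K).injective
  haveI : CharP (A ⊗[k] K) p :=
    charP_of_injective_algebraMap (algebraMap k (A ⊗[k] K)).injective p
  -- the nilpotent `b ⊗ 1 - c ⊗ α` of the characteristic-`p` ring `A ⊗ₖ K`
  have hx : (b ⊗ₜ[k] (1 : K) - c ⊗ₜ[k] α) ^ p = 0 := by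
    rw [sub_pow_char, Algebra.TensorProduct.tmul_pow, Algebra.TensorProduct.tmul_pow, one_pow,
      hα, hbc, Algebra.algebraMap_eq_smul_one (A := K) a, TensorProduct.tmul_smul,
      TensorProduct.smul_tmul', Algebra.smul_def, sub_self]
  have hx0 : b ⊗ₜ[k] (1 : K) - c ⊗ₜ[k] α = 0 := IsReduced.eq_zero _ ⟨p, hx⟩
  have key := congrArg (fun z => TensorProduct.rid k A (LinearMap.lTensor A φ z)) hx0
  simp only [map_sub, LinearMap.lTensor_tmul, TensorProduct.rid_tmul, hφ1, zero_smul, zero_sub,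
    map_zero, neg_eq_zero] at key
  apply nonZeroDivisors.ne_zero hc
  rw [← inv_smul_smul₀ hφα c, key, smul_zero]

end Algebra

/-! ## Lifting a resolution along an integral birational morphism -/

section Lift

/-- **A normal integral scheme is its own normalization**: `Y^ν → Y` is integral and
birational — an isomorphism over every non-empty affine open, whose coordinate ring is
integrally closed (`isIntegrallyClosed_sections_of_stalk`, `isIso_normalizationι_morphismRestrict`)
— hence an isomorphism (`isIso_of_isIntegralHom_of_isBirational`). [cite: StacksProject, Tag 0AB1] -/
theorem isIso_normalizationι_of_isIntegrallyClosed (Y : Scheme.{u}) [IsIntegral Y]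
    (hY : ∀ y : Y, IsIntegrallyClosed (Y.presheaf.stalk y)) : IsIso (normalizationι Y) := by
  refine isIso_of_isIntegralHom_of_isBirational _ hY ?_
  obtain ⟨y⟩ := (inferInstance : Nonempty Y)
  obtain ⟨_, ⟨W, hW, rfl⟩, hyW, -⟩ :=
    Y.isBasis_affineOpens.exists_subset_of_mem_open (Set.mem_univ y) isOpen_univ
  haveI : Nonempty W := ⟨⟨y, hyW⟩⟩
  have hic : IsIntegrallyClosed Γ(Y, W) := isIntegrallyClosed_sections_of_stalk hY ⟨W, hW⟩
  refine ⟨W, W.2.dense ⟨y, hyW⟩, ?_, isIso_normalizationι_morphismRestrict Y hW ⟨y, hyW⟩ hic⟩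
  obtain ⟨z, hz⟩ := (normalizationι Y).denseRange.exists_mem_open W.2 ⟨y, hyW⟩
  exact (normalizationι Y ⁻¹ᵁ W).2.dense ⟨z, hz⟩

/-- **Dominant morphisms from normal integral schemes lift through integral birational
morphisms** (universal property of normalization, Stacks 035I): for `Y` normal integral,
`π : Y → Z` dominant and `q : M → Z` integral birational between integral schemes, there is
`s : Y → M` with `s ≫ q = π`. Indeed `K(Z) = 𝒪_{Z,η} ≅ K(M)` gives `Spec K(Y) → M` over `Z`,
i.e. a factorisation of `Spec K(Y) → Y` through the integral `Y ×_Z M → Y`; the relative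
normalization `Y^ν` of `Y` in `Spec K(Y)` maps to `Y ×_Z M` over `Y` (Mathlib
`Scheme.Hom.normalizationDesc`), and `Y^ν → Y` is an isomorphism. [cite: StacksProject, Tag 035I] -/
theorem exists_lift_of_isIntegralHom_of_isBirational {Y M Z : Scheme.{u}} [IsIntegral Y]
    [IsIntegral M] [IsIntegral Z] (hY : ∀ y : Y, IsIntegrallyClosed (Y.presheaf.stalk y))
    (π : Y ⟶ Z) [IsDominant π] (q : M ⟶ Z) [IsIntegralHom q] (hq : IsBirational q) :
    ∃ s : Y ⟶ M, s ≫ q = π := by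
  haveI : IsDominant q := hq.isDominant
  haveI := hq.isIso_stalkMap_genericPoint
  have hsp : π (genericPoint Y) ⤳ q (genericPoint M) := by
    rw [genericPoint_eq_of_isDominant q, genericPoint_eq_of_isDominant π]
  -- the generic lift `Spec K(Y) → M`
  let ψ : M.presheaf.stalk (genericPoint M) ⟶ Y.functionField :=
    inv (q.stalkMap (genericPoint M)) ≫ Z.presheaf.stalkSpecializes hsp ≫
      π.stalkMap (genericPoint Y)
  let lam : Spec Y.functionField ⟶ M := Spec.map ψ ≫ M.fromSpecStalk (genericPoint M)
  have e1 : M.fromSpecStalk (genericPoint M) ≫ q =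
      Spec.map (q.stalkMap (genericPoint M)) ≫ Z.fromSpecStalk _ :=
    (Scheme.SpecMap_stalkMap_fromSpecStalk q).symm
  have hlam : lam ≫ q = fromSpecFunctionField Y ≫ π := by
    simp only [lam, ψ, Spec.map_comp, Category.assoc, Spec.map_inv]
    rw [e1, IsIso.inv_hom_id_assoc, Scheme.SpecMap_stalkSpecializes_fromSpecStalk,
      Scheme.SpecMap_stalkMap_fromSpecStalk]
  -- the factorisation of `Spec K(Y) → Y` through the integral `Y ×_Z M → Y`
  let f₁ : Spec Y.functionField ⟶ pullback π q :=
    pullback.lift (fromSpecFunctionField Y) lam hlam.symm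
  have H : fromSpecFunctionField Y = f₁ ≫ pullback.fst π q := (pullback.lift_fst _ _ _).symm
  haveI : IsIntegralHom (pullback.fst π q) := MorphismProperty.pullback_fst _ _ ‹_›
  let d : normalization Y ⟶ pullback π q :=
    (fromSpecFunctionField Y).normalizationDesc f₁ (pullback.fst π q) H
  have hd : d ≫ pullback.fst π q = normalizationι Y :=
    (fromSpecFunctionField Y).normalizationDesc_comp _ _ H
  haveI : IsIso (normalizationι Y) := isIso_normalizationι_of_isIntegrallyClosed Y hY
  refine ⟨inv (normalizationι Y) ≫ d ≫ pullback.snd π q, ?_⟩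
  rw [Category.assoc, Category.assoc, ← pullback.condition, reassoc_of% hd,
    IsIso.inv_hom_id_assoc]

/-- **Birationality of a factor**: if `q : M → Z` and `s ≫ q : Y → Z` are birational, with `Y`
and `M` irreducible, then so is `s : Y → M` — over `q⁻¹(U₁ ∩ U₂)`, where `U₁`, `U₂ ⊆ Z` are the
dense opens over which `s ≫ q` and `q` are isomorphisms (`U₁ ∩ U₂ ≠ ∅`), `s` restricts to
(isomorphism) ≫ (isomorphism)⁻¹. [folklore] -/
theorem isBirational_of_comp {Y M Z : Scheme.{u}} [IrreducibleSpace Y] [IrreducibleSpace M]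
    {s : Y ⟶ M} {q : M ⟶ Z} (hq : IsBirational q) (h : IsBirational (s ≫ q)) :
    IsBirational s := by
  obtain ⟨U₁, hU₁, -, hiso₁⟩ := h
  obtain ⟨U₂, hU₂, -, hiso₂⟩ := hq
  haveI : Nonempty Z := ⟨q (Classical.arbitrary M)⟩
  have hne : ((U₁ ⊓ U₂ : Z.Opens) : Set Z).Nonempty := by
    rw [Opens.coe_inf, Set.inter_comm]
    exact hU₁.inter_open_nonempty U₂ U₂.2 hU₂.nonempty
  haveI h₁ : IsIso ((s ≫ q) ∣_ (U₁ ⊓ U₂)) := isIso_morphismRestrict_of_le _ hiso₁ inf_le_left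
  haveI h₂ : IsIso (q ∣_ (U₁ ⊓ U₂)) := isIso_morphismRestrict_of_le _ hiso₂ inf_le_right
  obtain ⟨x, hx⟩ := hne
  let y : ↥((s ≫ q) ⁻¹ᵁ (U₁ ⊓ U₂)) :=
    (Scheme.homeoOfIso (asIso ((s ≫ q) ∣_ (U₁ ⊓ U₂)))).symm ⟨x, hx⟩
  have hy : (y : Y) ∈ (s ≫ q) ⁻¹ᵁ (U₁ ⊓ U₂) := y.2
  refine ⟨q ⁻¹ᵁ (U₁ ⊓ U₂), ?_, ?_, ?_⟩
  · exact (q ⁻¹ᵁ (U₁ ⊓ U₂)).2.dense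
      ⟨s y, show q (s y) ∈ U₁ ⊓ U₂ by rw [← Scheme.Hom.comp_apply]; exact hy⟩
  · rw [← Scheme.Hom.comp_preimage]
    exact ((s ≫ q) ⁻¹ᵁ (U₁ ⊓ U₂)).2.dense ⟨y, hy⟩
  · haveI : IsIso (s ∣_ q ⁻¹ᵁ (U₁ ⊓ U₂) ≫ q ∣_ (U₁ ⊓ U₂)) := by
      rw [← morphismRestrict_comp]
      exact h₁
    exact IsIso.of_isIso_comp_right (s ∣_ q ⁻¹ᵁ (U₁ ⊓ U₂)) (q ∣_ (U₁ ⊓ U₂))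

/-- **Resolutions lift along integral birational morphisms of integral schemes.** If
`q : M → Z` is integral (e.g. finite) and birational between integral schemes and `π : Y → Z` is
a resolution, then `Y` is regular, hence normal (Matsumura, Thm. 19.4) and integral, `π` lifts
to `s : Y → M` with `s ≫ q = π` (`exists_lift_of_isIntegralHom_of_isBirational`), and `s` is a
resolution of `M`: proper by cancellation (`q` is affine, hence separated) and birational
(`isBirational_of_comp`). [folklore] -/
theorem hasResolution_of_isIntegralHom_of_isBirational {M Z : Scheme.{u}} [IsIntegral M]
    [IsIntegral Z] (q : M ⟶ Z) [IsIntegralHom q] (hq : IsBirational q)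
    (h : Scheme.HasResolution Z) : Scheme.HasResolution M := by
  obtain ⟨Y, π, hπ⟩ := h
  haveI := hπ.isProper
  have hY : ∀ y : Y, IsIntegrallyClosed (Y.presheaf.stalk y) := fun y =>
    haveI := hπ.isRegular y
    isIntegrallyClosed_of_isRegularLocalRing _
  haveI : IsReduced Y := hπ.isRegular.isReduced
  haveI : IsIntegral Y := hπ.isBirational.isIntegral
  haveI : IsDominant π := hπ.isBirational.isDominant
  obtain ⟨s, hs⟩ := exists_lift_of_isIntegralHom_of_isBirational hY π q hq
  haveI : IsProper (s ≫ q) := by rw [hs]; infer_instance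
  haveI : IsProper s := IsProper.of_comp s q
  exact ⟨Y, s, ‹_›, isBirational_of_comp hq (hs ▸ hπ.isBirational), hπ.isRegular⟩

/-- **Base change of a birational morphism along a surjection, irreducible case**: in a
cartesian square `(q, p', b, ν)` (`q : P → S` the base change of the birational `ν : X' → X`
along the surjective `b : S → X`, `p' : P → X'` surjective) with `P` and `S` irreducible, `q` is
birational: it is an isomorphism over `b⁻¹(W)` if `ν` is one over `W`. [folklore] -/
theorem isBirational_of_isPullback {P X' S X : Scheme.{u}} [IrreducibleSpace P]
    [IrreducibleSpace S] {q : P ⟶ S} {p' : P ⟶ X'} {b : S ⟶ X} {ν : X' ⟶ X}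
    (sq : IsPullback q p' b ν) [Surjective b] [Surjective p'] (hν : IsBirational ν) :
    IsBirational q := by
  obtain ⟨W, hW, hW', hiso⟩ := hν
  haveI : Nonempty X := ⟨b (Classical.arbitrary S)⟩
  haveI : Nonempty X' := ⟨p' (Classical.arbitrary P)⟩
  obtain ⟨x, hx⟩ := hW.nonempty
  obtain ⟨x', hx'⟩ := hW'.nonempty
  refine ⟨b ⁻¹ᵁ W, ?_, ?_, ?_⟩
  · obtain ⟨y, hy⟩ := b.surjective x
    exact (b ⁻¹ᵁ W).2.dense ⟨y, show b y ∈ W by rwa [hy]⟩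
  · obtain ⟨y, hy⟩ := p'.surjective x'
    rw [← Scheme.Hom.comp_preimage, sq.w, Scheme.Hom.comp_preimage]
    exact (p' ⁻¹ᵁ (ν ⁻¹ᵁ W)).2.dense ⟨y, show p' y ∈ ν ⁻¹ᵁ W by rwa [hy]⟩
  · obtain ⟨g', sqW⟩ := exists_isPullback_morphismRestrict sq W
    exact MorphismProperty.of_isPullback (P := .isomorphisms Scheme) sqW.flip hiso

end Lift

/-! ## Integrality of `X^ν ×ₖ Spec K` -/

section Normalization

variable {k K : Type u} [Field k] [Field K] [Algebra k K] {p : ℕ} [Fact p.Prime] [CharP k p]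
  {X : Scheme.{u}} [IsIntegral X] (f : X ⟶ Spec (.of k))

/-- **`a ∉ k(X)^p` if `X ×ₖ Spec K` is reduced** (`K = k(a^{1/p})`): over a non-empty affine
open `U = Spec A` of `X`, `Spec (A ⊗ₖ K) ≅ U ×ₖ Spec K` is an open subscheme of `X ×ₖ Spec K`,
so `A ⊗ₖ K` is reduced and `pow_ne_of_isReduced_tensorProduct` applies in `k(X) = Frac A`.
[folklore] -/
theorem functionField_pow_ne (a : k) (α : K) (ha : ∀ b : k, b ^ p ≠ a)
    (hα : α ^ p = algebraMap k K a)
    [IsReduced (pullback f (Spec.map (CommRingCat.ofHom (algebraMap k K))))]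
    (γ : X.functionField) :
    γ ^ p ≠ X.presheaf.germ ⊤ (genericPoint X) trivial
      (((Scheme.ΓSpecIso (.of k)).inv ≫ f.appLE ⊤ ⊤ le_top) a) := by
  set g := Spec.map (CommRingCat.ofHom (algebraMap k K))
  obtain ⟨U, hU, hηU, -⟩ :=
    exists_isAffineOpen_mem_and_subset (show genericPoint X ∈ (⊤ : X.Opens) from trivial)
  haveI : Nonempty U := ⟨⟨_, hηU⟩⟩
  letI : Algebra k X.functionField := ((X.presheaf.germ ⊤ (genericPoint X) trivial).hom.comp
    ((Scheme.ΓSpecIso (.of k)).inv ≫ f.appLE ⊤ ⊤ le_top).hom).toAlgebra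
  letI : Algebra k Γ(X, U) :=
    ((Scheme.ΓSpecIso (.of k)).inv ≫ f.appLE ⊤ U le_top).hom.toAlgebra
  haveI : IsScalarTower k Γ(X, U) X.functionField :=
    IsScalarTower.of_algebraMap_eq fun x => by
      show X.presheaf.germ ⊤ (genericPoint X) trivial
          (((Scheme.ΓSpecIso (.of k)).inv ≫ f.appLE ⊤ ⊤ le_top) x) =
        X.germToFunctionField U (((Scheme.ΓSpecIso (.of k)).inv ≫ f.appLE ⊤ U le_top) x)
      rw [← map_kToΓ f (le_top : U ≤ ⊤)]
      exact (X.presheaf.germ_res_apply (homOfLE le_top) _ _ _).symm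
  haveI : IsFractionRing Γ(X, U) X.functionField :=
    functionField_isFractionRing_of_isAffineOpen X U hU
  -- `A ⊗ₖ K` is reduced: `Spec (A ⊗ₖ K) → X ×ₖ Spec K` is an open immersion
  haveI : _root_.IsReduced (Γ(X, U) ⊗[k] K) := by
    have hj : hU.fromSpec ≫ f = Spec.map (CommRingCat.ofHom (algebraMap k Γ(X, U))) :=
      fromSpec_comp_eq_SpecMap f hU
    let e : Spec (.of (Γ(X, U) ⊗[k] K)) ≅ pullback hU.fromSpec (pullback.fst f g) :=
      (pullbackSpecIso k Γ(X, U) K).symm ≪≫ (pullback.congrHom (g₁ := g) hj rfl).symm ≪≫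
        (pullbackRightPullbackFstIso f g hU.fromSpec).symm
    haveI : IsReduced (Spec (.of (Γ(X, U) ⊗[k] K))) :=
      isReduced_of_isOpenImmersion (e.hom ≫ pullback.snd hU.fromSpec (pullback.fst f g))
    exact (affine_isReduced_iff (.of (Γ(X, U) ⊗[k] K))).mp this
  exact pow_ne_of_isReduced_tensorProduct (A := Γ(X, U)) a α ha hα γ

/-- `a ∉ k(X^ν)^p` if `X ×ₖ Spec K` is reduced: `k(X) ≅ k(X^ν)` through the stalk map of the
birational `X^ν → X` at the generic point (`functionField_pow_ne`). [folklore] -/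
theorem functionField_normalization_pow_ne [LocallyOfFiniteType f] (a : k) (α : K)
    (ha : ∀ b : k, b ^ p ≠ a) (hα : α ^ p = algebraMap k K a)
    [IsReduced (pullback f (Spec.map (CommRingCat.ofHom (algebraMap k K))))]
    (γ : (normalization X).functionField) :
    γ ^ p ≠ (normalization X).presheaf.germ ⊤ (genericPoint (normalization X)) trivial
      (((Scheme.ΓSpecIso (.of k)).inv ≫ (normalizationι X ≫ f).appLE ⊤ ⊤ le_top) a) := by
  intro hγ
  set ν := normalizationι X
  set η := genericPoint (normalization X)
  haveI := (isBirational_normalizationι X f).isIso_stalkMap_genericPoint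
  obtain ⟨γ₀, rfl⟩ := (ConcreteCategory.bijective_of_isIso (ν.stalkMap η)).2 γ
  have hsp : genericPoint X ⤳ ν η := (genericPoint_spec X).specializes (Set.mem_univ _)
  refine functionField_pow_ne f a α ha hα (X.presheaf.stalkSpecializes hsp γ₀) ?_
  have h1 : ν.stalkMap η (γ₀ ^ p) = ν.stalkMap η (X.presheaf.germ ⊤ (ν η) trivial
      (((Scheme.ΓSpecIso (.of k)).inv ≫ f.appLE ⊤ ⊤ le_top) a)) := by
    rw [map_pow, hγ, CommRingCat.comp_apply, CommRingCat.comp_apply]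
    simp only [Scheme.Hom.appLE, Scheme.Hom.comp_app, CommRingCat.comp_apply,
      TopCat.Presheaf.germ_res_apply, Scheme.Hom.germ_stalkMap_apply]
    rfl
  have h2 := (ConcreteCategory.bijective_of_isIso (ν.stalkMap η)).1 h1
  rw [← map_pow, h2, TopCat.Presheaf.germ_stalkSpecializes_apply]

/-- **`X^ν ×ₖ Spec K` is integral if `X ×ₖ Spec K` is** (`K = k(a^{1/p})`, `X` integral
locally of finite type over `k`): it is reduced because `a ∉ k(X^ν)^p`
(`isReduced_pullback_of_forall_pow_ne`), and irreducible because `X^ν ×ₖ Spec K → X^ν` is a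
homeomorphism (finite, radicial — `K/k` is purely inseparable — and surjective). [folklore] -/
theorem isIntegral_pullback_normalization [LocallyOfFiniteType f] (a : k) (α : K)
    (ha : ∀ b : k, b ^ p ≠ a) (hα : α ^ p = algebraMap k K a)
    (htop : IntermediateField.adjoin k {α} = ⊤)
    [IsIntegral (pullback f (Spec.map (CommRingCat.ofHom (algebraMap k K))))] :
    IsIntegral
      (pullback (normalizationι X ≫ f) (Spec.map (CommRingCat.ofHom (algebraMap k K)))) := by
  set g := Spec.map (CommRingCat.ofHom (algebraMap k K))
  haveI : IsReduced (pullback (normalizationι X ≫ f) g) :=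
    isReduced_pullback_of_forall_pow_ne (normalizationι X ≫ f) a α hα htop
      (functionField_normalization_pow_ne f a α ha hα)
  -- `X^ν ×ₖ Spec K → X^ν` is a homeomorphism
  haveI : IsPurelyInseparable k K := by
    rw [isPurelyInseparable_iff_perfectClosure_eq_top, eq_top_iff, ← htop,
      IntermediateField.adjoin_simple_le_iff, mem_perfectClosure_iff_pow_mem p]
    exact ⟨1, a, by rw [pow_one, hα]⟩
  haveI : FiniteDimensional k (⊤ : IntermediateField k K) := by
    rw [← htop]; exact IntermediateField.adjoin.finiteDimensional (isIntegral_of_pow_eq a α hα)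
  haveI : FiniteDimensional k K := IntermediateField.topEquiv.toLinearEquiv.finiteDimensional
  haveI : IsFinite g := by
    rw [IsFinite.SpecMap_iff, CommRingCat.hom_ofHom, RingHom.finite_algebraMap]
    infer_instance
  haveI := universallyInjective_SpecMap_of_isPurelyInseparable k K
  set q' := pullback.fst (normalizationι X ≫ f) g
  haveI : IsFinite q' := MorphismProperty.pullback_fst _ _ inferInstance
  haveI : UniversallyInjective q' := MorphismProperty.pullback_fst _ _ inferInstance
  haveI : Surjective q' := MorphismProperty.pullback_fst _ _ inferInstance
  have hφ : IsHomeomorph q' := isHomeomorph_iff_continuous_isClosedMap_bijective.mpr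
    ⟨q'.continuous, q'.isClosedMap, q'.injective, q'.surjective⟩
  haveI : IrreducibleSpace ↥(pullback (normalizationι X ≫ f) g) :=
    (hφ.homeomorph q').irreducibleSpace_iff.mpr inferInstance
  exact isIntegral_of_irreducibleSpace_of_isReduced _

end Normalization

/-- STUB `stub_oneRootNormalization` (R3): the core for NORMAL integral `X` implies the core
for integral `X`. Pass to the normalization `ν : X^ν → X` (finite, birational; `X^ν` normal):
a resolution of `X^ν` gives one of `X` (`Scheme.HasResolution.of_normalization`),
`X^ν ×ₖ Spec K` is integral (`isIntegral_pullback_normalization`), and a resolution of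
`X ×ₖ Spec K` lifts along the finite birational base change `X^ν ×ₖ Spec K → X ×ₖ Spec K` of
`ν`, regular schemes being normal (`hasResolution_of_isIntegralHom_of_isBirational`).
[folklore] -/
theorem stub_oneRootNormalization : ∀ (p : ℕ) [Fact p.Prime], (∀ (k K : Type) [Field k] [Field K] [Algebra k K] [CharP k p] (a : k) (α : K), (∀ b : k, b ^ p ≠ a) → α ^ p = algebraMap k K a → IntermediateField.adjoin k {α} = ⊤ → ∀ (X : Scheme.{0}) (f : X ⟶ Spec (.of k)), IsSeparated f → LocallyOfFiniteType f → QuasiCompact f → IsIntegral X → (∀ x : X, IsIntegrallyClosed (X.presheaf.stalk x)) → IsIntegral (pullback f (Spec.map (CommRingCat.ofHom (algebraMap k K)))) → Scheme.HasResolution (pullback f (Spec.map (CommRingCat.ofHom (algebraMap k K)))) → Scheme.HasResolution X) → (∀ (k K : Type) [Field k] [Field K] [Algebra k K] [CharP k p] (a : k) (α : K), (∀ b : k, b ^ p ≠ a) → α ^ p = algebraMap k K a → IntermediateField.adjoin k {α} = ⊤ → ∀ (X : Scheme.{0}) (f : X ⟶ Spec (.of k)), IsSeparated f → LocallyOfFiniteType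 f → QuasiCompact f → IsIntegral X → IsIntegral (pullback f (Spec.map (CommRingCat.ofHom (algebraMap k K)))) → Scheme.HasResolution (pullback f (Spec.map (CommRingCat.ofHom (algebraMap k K)))) → Scheme.HasResolution X) := by
  intro p _ hnorm k K _ _ _ _ a α ha hα htop X f hsep hlft hqc hint hintK hresK
  haveI := hsep; haveI := hlft; haveI := hqc; haveI := hint; haveI := hintK
  set g := Spec.map (CommRingCat.ofHom (algebraMap k K))
  set ν := normalizationι X
  haveI : IsFinite ν := isFinite_normalizationι X NoetherFiniteIntegralClosure_holds f
  refine Scheme.HasResolution.of_normalization X f ?_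
  haveI := isIntegral_pullback_normalization f a α ha hα htop
  refine hnorm k K a α ha hα htop (normalization X) (ν ≫ f) inferInstance inferInstance
    inferInstance inferInstance (isIntegrallyClosed_stalk_normalization X) ‹_› ?_
  -- the base change `q : X^ν ×ₖ Spec K → X ×ₖ Spec K` of `ν` and its cartesian square
  let q : pullback (ν ≫ f) g ⟶ pullback f g :=
    pullback.lift (pullback.fst (ν ≫ f) g ≫ ν) (pullback.snd (ν ≫ f) g)
      (by rw [Category.assoc, pullback.condition])
  have hq₁ : q ≫ pullback.fst f g = pullback.fst (ν ≫ f) g ≫ ν := pullback.lift_fst _ _ _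
  have sq : IsPullback q (pullback.fst (ν ≫ f) g) (pullback.fst f g) ν := by
    refine (IsPullback.of_bot (v₁₁ := q) (v₂₁ := pullback.snd f g) ?_ hq₁.symm
      (IsPullback.of_hasPullback f g)).flip
    rw [pullback.lift_snd]
    exact IsPullback.of_hasPullback (ν ≫ f) g
  haveI : IsFinite q := MorphismProperty.of_isPullback sq.flip inferInstance
  haveI : Surjective (pullback.fst f g) := MorphismProperty.pullback_fst _ _ inferInstance
  haveI : Surjective (pullback.fst (ν ≫ f) g) :=
    MorphismProperty.pullback_fst _ _ inferInstance
  exact hasResolution_of_isIntegralHom_of_isBirational q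
    (isBirational_of_isPullback sq (isBirational_normalizationι X f)) hresK

end Summit.ResolutionOfSingularities.ResolutionOfSingularities.Theorems

end
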